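import Summits.QuantumFields.YangMills.Theorems.BalabanUVNodesN26AtRecord13Sep

/-!
# DAG node N26 — THE N26 ∕ K2 FACES KEYED ONCE AT NODE 00's bg-FREE CORE DATUM `Node00.datumOfRecord₁₃Core θ (hc : θ.Provisos₁₃Core F N)` (def-T `Node00/Record13.lean`
# v1.2 §9): the LAST re-key of this lineage's datum-level faces — every item edition's datum (`datumOfRecord₁₃` v1.1, `datumOfRecord₁₃Sep` v1.2, `datumOfRecord₁₃SepMixed` v1.3, …)
# IS the Core datum at `h.toCore` by `rfl`

Cell `pub-ymgap`, YM-PLAN Track A (HUMAN RULING D-0062), seat `pub-ymgap-dag-n26-c` gen 9 (R134 acceleration seat, s2); helper for crux K2⁗ `EndpointGivenBR13Sep` (stmt-QuantumFields-20291)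
and its rev-20 successor K2⁵ (token map `…₁₃Sep ↦ …₁₃SepMixed`, director-ym №142 (S3)(S4)).  WHY: plan g67 CORE-YES (2026-08-27T07:07Z, on dag-n22-e DESIGN-INPUT-CORE; plan WORD-139 (1)):
«bg-blind, proviso-FIELD-blind CONSUMER storeys key ONCE on `(hc : θ.Provisos₁₃Core F N)` ∕ `datumOfRecord₁₃Core` and are applied at any item edition by `hc := h.toCore`, datum by
`rfl`; the ITEM texts and the registered STUB texts stay edition-keyed».  N26's β-side never reads a proviso: `h` enters this lineage's faces ONLY as a binder type and inside the datum
(p504252's header).  So p504252's §0 adapter and §1 faces are re-issued here at the Core datum, with the `rfl` bridges that make the v1.1 ∕ v1.2 faces their instances; the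
edition-keyed STUB-TEXT theorems (p504252 §4, p505923 §4) are NOT twinned here (they follow the registered text of each edition in a thin junction file).

WHAT IS HERE (0 `def`, 0 `sorry`; every proof `rfl` ∕ `Iff.rfl` ∕ one application of a landed theorem):
* §0 `betaContH_datumOfRecord₁₃Core_iff` (`Iff.rfl`), ★ `n26_datumOfRecord₁₃Core_of_betaContH` — THE UNIVERSAL ADAPTER AT CORE: any `BetaContH γ₀ (betaOfRecord₁₃ F N θ)` face with `0 < γ₀`
  ⟹ N26's literal at `datumOfRecord₁₃Core θ hc`; the edition bridges `n26_datumOfRecord₁₃Sep_iff_core` ∕ `endpointExistence_datumOfRecord₁₃Sep_iff_core` ∕ `n26_datumOfRecord₁₃_iff_core` ∕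
  `endpointExistence_datumOfRecord₁₃_iff_core` (`Iff.rfl` along def-T's `datumOfRecord₁₃Sep_eq_core` ∕ `datumOfRecord₁₃_eq_core`).
* §1 at the Core datum: `n26_datumOfRecord₁₃Core_of_atSlopeCont`, `endpoint_and_n26_datumOfRecord₁₃Core_of_residue_atSlopeCont` (the registered pair's currency), ★
  `endpoint_and_n26_datumOfRecord₁₃Core_of_drift_atSlopeCont` (K2 AT θ FROM THE JETS-FREE PAIR, p504252's road at Core).
* §2 THE JUNCTION SHAPE for composers: `endpoint_and_n26_of_eq_datumOfRecord₁₃Core_of_drift_atSlopeCont` — for ANY datum `D = datumOfRecord₁₃Core F N θ hc` (the sentence an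
  edition's record predicate `IsRecordOfRecord₁₃C…` delivers after `.toCore`), the jets-free pair ⟹ `EndpointExistence D.C.toB12 ∧ ∃ γc > 0, BetaContH γc D.βfun`; USE note: p504252's v1.2 face is
  the Core face at `hP.toCore` (one application, datum by `rfl`) — the pattern every later edition repeats.

HONEST FRAMING.  Re-keying bookkeeping (`rfl`-level); nothing of Bałaban's analysis asserted; (D4) INSTANCE 0∕1; `stub_d1Residue13` ∕ `stub_d4AtSlopeCont13` ∕ K2⁗ NOT proved; N25 ∕ N26 NOT
discharged (N26 VACATED ∕ (D4)-dependent; counts unmoved 5∕27 · A 5∕28); general `N`; one finite four-torus programme at fixed ε per run — NOT the continuum limit, NOT ℝ⁴, NOT OS, NOT a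
mass gap, NOT Clay.  No `instance`, no `notation`, no `axiom`.
Sources (context): [I] = [Balaban1987RG1] CMP **109** (1987): Thm 2 p. 259 (first sentence), (1.20)–(1.22) p. 264, (2.12)–(2.14) p. 268, (5.10) p. 293; [II] = [Balaban1988RG2Cluster]
CMP **116** (1988): Lemma 3 (2.38) p. 20, (2.41) p. 21; [III] = [Balaban1988Convergent] CMP **119** (1988): (0.2) p. 244; [6] = [Balaban1989LargeFieldII] CMP **122** (1989): Thm 1 +
(0.1) pp. 355–356.
-/

noncomputable section

open scoped Matrix.Norms.L2Operator

namespace Summit.QuantumFields.YangMills.Theorems.BalabanUVNodesN26AtRecord13Core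

open Literature.MathematicalPhysics.QuantumFieldTheory.Balaban1983to89
open Literature.MathematicalPhysics.QuantumFieldTheory.Balaban1983to89.FlowStep
open Literature.MathematicalPhysics.QuantumFieldTheory.Balaban1983to89.DagBinding (EndpointExistence)
open Literature.MathematicalPhysics.QuantumFieldTheory.Balaban1983to89.T4Continuum (T4Family FiniteEpsData)
open Literature.MathematicalPhysics.QuantumFieldTheory.Balaban1983to89.Node00
open Literature.MathematicalPhysics.QuantumFieldTheory.Balaban1983to89.Beta.OneStepKernelFamily (TbalOf)
open Literature.MathematicalPhysics.QuantumFieldTheory.Balaban1983to89.Beta.OneStepResolventKernel (JetData)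
open Literature.MathematicalPhysics.QuantumFieldTheory.Balaban1983to89.Beta.Drift (OneLoopDrift)
open Summit.QuantumFields.BalabanUV.Gaps
open Summit.QuantumFields.BalabanUV.Gaps.BetaContFromD4Chain
open Literature.MathematicalPhysics.QuantumFieldTheory.Balaban1983to89.Beta.DriftRemainder (endpointExistence_of_drift_remainderConst_cont)
open Filter Topology

variable (F : T4Family) (N : ℕ) [NeZero N]

/-! ## §0 The universal adapter at the Core datum, and the edition bridges (`rfl`) -/

section Adapter

variable (θ : Stage13Params F N)

/-- **B4 on a box at the Core datum ⟺ B4 at `betaOfRecord₁₃ F N θ`** (def-T `βfun_datumOfRecord₁₃Core`, `rfl`). [cite: Balaban1987RG1, (1.20)–(1.22) p.264 (bookkeeping)] -/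
theorem betaContH_datumOfRecord₁₃Core_iff (hc : θ.Provisos₁₃Core F N) (γ : ℝ) :
    BetaContH γ (datumOfRecord₁₃Core F N θ hc).βfun ↔ BetaContH γ (betaOfRecord₁₃ F N θ) := Iff.rfl

/-- **★ THE UNIVERSAL ADAPTER AT CORE — N26 AT `datumOfRecord₁₃Core θ hc` FROM ANY B4 FACE AT `betaOfRecord₁₃ F N θ` ON A BOX `0 < γ₀`** (every `betaContH_betaOfRecord₁₃_X` theorem of this
lineage, in ONE application; at an item edition take `hc := h.toCore`).  Instance 0∕1; N26 NOT discharged. [cite: Balaban1987RG1, (1.20)–(1.22) p.264; Balaban1989LargeFieldII, Thm 1 + (0.1) pp.355–356] -/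
theorem n26_datumOfRecord₁₃Core_of_betaContH (hc : θ.Provisos₁₃Core F N) {γ₀ : ℝ} (hγ₀ : 0 < γ₀) (h : BetaContH γ₀ (betaOfRecord₁₃ F N θ)) :
    ∃ γc : ℝ, 0 < γc ∧ BetaContH γc (datumOfRecord₁₃Core F N θ hc).βfun :=
  ⟨γ₀, hγ₀, h⟩

/-- **EDITION BRIDGE (v1.2)**: N26 at the separated-range datum IS N26 at the Core datum at `h.toCore` (def-T `datumOfRecord₁₃Sep_eq_core`, `rfl`).
[cite: Balaban1989LargeFieldII, Thm 1 + (0.1) pp.355–356 (bookkeeping)] -/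
theorem n26_datumOfRecord₁₃Sep_iff_core (h : θ.Provisos₁₃Sep F N) :
    (∃ γc : ℝ, 0 < γc ∧ BetaContH γc (datumOfRecord₁₃Sep F N θ h).βfun) ↔
      ∃ γc : ℝ, 0 < γc ∧ BetaContH γc (datumOfRecord₁₃Core F N θ h.toCore).βfun := Iff.rfl

/-- **EDITION BRIDGE (v1.2)**: N25's END at the separated-range datum IS the END at the Core datum at `h.toCore` (`rfl`). [cite: Balaban1987RG1, Thm 2 p.259 (first sentence; bookkeeping)] -/
theorem endpointExistence_datumOfRecord₁₃Sep_iff_core (h : θ.Provisos₁₃Sep F N) :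
    EndpointExistence (datumOfRecord₁₃Sep F N θ h).C.toB12 ↔ EndpointExistence (datumOfRecord₁₃Core F N θ h.toCore).C.toB12 := Iff.rfl

/-- **EDITION BRIDGE (v1.1)**: N26 at the v1.1 datum IS N26 at the Core datum at `h.toCore` (def-T `datumOfRecord₁₃_eq_core`, `rfl`).
[cite: Balaban1989LargeFieldII, Thm 1 + (0.1) pp.355–356 (bookkeeping)] -/
theorem n26_datumOfRecord₁₃_iff_core (h : θ.Provisos₁₃ F N) :
    (∃ γc : ℝ, 0 < γc ∧ BetaContH γc (datumOfRecord₁₃ F N θ h).βfun) ↔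
      ∃ γc : ℝ, 0 < γc ∧ BetaContH γc (datumOfRecord₁₃Core F N θ h.toCore).βfun := Iff.rfl

/-- **EDITION BRIDGE (v1.1)**: N25's END at the v1.1 datum IS the END at the Core datum at `h.toCore` (`rfl`). [cite: Balaban1987RG1, Thm 2 p.259 (first sentence; bookkeeping)] -/
theorem endpointExistence_datumOfRecord₁₃_iff_core (h : θ.Provisos₁₃ F N) :
    EndpointExistence (datumOfRecord₁₃ F N θ h).C.toB12 ↔ EndpointExistence (datumOfRecord₁₃Core F N θ h.toCore).C.toB12 := Iff.rfl

end Adapter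

/-! ## §1 The generic faces at the Core datum: residue ∕ (D1) + (D4) currencies, and K2 at θ from the jets-free pair -/

section AtDatum

variable (θ : Stage13Params F N)

/-- **N26 AT THE CORE DATUM FROM THE ROWS-(D4) ∧ B4 RESIDUE** at ANY split of the datum's β on a box `0 < γ₀`, any slope (`Gaps.BetaContFromD4Chain.betaContH_of_atSlopeCont`).
A located hypothesis of NODE O; instance 0∕1. [cite: Balaban1988RG2Cluster, Lemma 3 (2.38) p.20; Balaban1987RG1, (1.20)–(1.22) p.264 and (5.10) p.293] -/
theorem n26_datumOfRecord₁₃Core_of_atSlopeCont (hc : θ.Provisos₁₃Core F N) {γ₀ : ℝ} (hγ₀ : 0 < γ₀)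
    {Sβ : B12Beta.OneLoopSplit (datumOfRecord₁₃Core F N θ hc).βfun} {s : ℝ} (h : AtSlopeCont Sβ γ₀ s) :
    ∃ γc : ℝ, 0 < γc ∧ BetaContH γc (datumOfRecord₁₃Core F N θ hc).βfun :=
  ⟨γ₀, hγ₀, betaContH_of_atSlopeCont h⟩

/-- **N25's END ∧ N26 AT THE CORE DATUM, REGISTERED CURRENCY**: row (D1)'s residue `Gaps.D1Residue.Residue Lc Js Nc μ ν` pinned on the one-loop field of a split `Sβ` of the datum's β +
the rows-(D4) ∧ B4 residue `AtSlopeCont Sβ γ₀ (stepBal Nc Lc)` on a box `0 < γ₀` (`Gaps.BetaContFromD4Chain.endpointExistence_of_residue_atSlopeCont` at the datum's own `fwd`).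
Instance 0∕1 on both predicates. [cite: Balaban1987RG1, Thm 2 p.259 (first sentence), (1.20)–(1.22) p.264 and (2.12)–(2.14) p.268; Balaban1988RG2Cluster, Lemma 3 (2.38) p.20] -/
theorem endpoint_and_n26_datumOfRecord₁₃Core_of_residue_atSlopeCont (hc : θ.Provisos₁₃Core F N)
    (Sβ : B12Beta.OneLoopSplit (datumOfRecord₁₃Core F N θ hc).βfun) {Lc : ℕ} [NeZero Lc] (Js : ℕ → JetData 3 Lc) {Nc : ℝ} {μ ν : Fin 4}
    (hβ : ∀ j, Sβ.β0 j = B12Beta.secondMoment (TbalOf Lc Js j) μ ν) (h1 : D1Residue.Residue Lc Js Nc μ ν) {γ₀ : ℝ} (hγ₀ : 0 < γ₀)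
    (hres : AtSlopeCont Sβ γ₀ (B12Normalization.stepBal Nc Lc)) :
    EndpointExistence (datumOfRecord₁₃Core F N θ hc).C.toB12 ∧ ∃ γc : ℝ, 0 < γc ∧ BetaContH γc (datumOfRecord₁₃Core F N θ hc).βfun :=
  ⟨endpointExistence_of_residue_atSlopeCont (datumOfRecord₁₃Core F N θ hc).fwd Sβ Js hβ h1 hγ₀ hres, γ₀, hγ₀, betaContH_of_atSlopeCont hres⟩

/-- **★ CRUX K2 AT θ FROM THE JETS-FREE PAIR, AT THE CORE DATUM**: a drift `OneLoopDrift d A β⁰_θ` of the record's one-loop numbers + the rows-(D4) ∧ B4 residue `AtSlopeCont (split₁₃ θ) γ₀ d`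
at that slope on a box `0 < γ₀` ⟹ N25's END ∧ N26 at `datumOfRecord₁₃Core θ hc` — NO jets, NO `Residue`, NO `(Lc, Nc)` (`Beta.DriftRemainder.endpointExistence_of_drift_remainderConst_cont` at the
datum's own `fwd`, `r := b := d`, with `remainderConst_of_atSlopeCont` ∕ `betaContH_of_atSlopeCont` — p504252's proof at Core).  At an item edition: `hc := h.toCore`, datum by `rfl` (§2).
Instance 0∕1; N25 ∕ N26 NOT discharged.
[cite: Balaban1987RG1, Thm 2 p.259 (first sentence), (1.20)–(1.22) p.264 and (2.12)–(2.14) p.268; Balaban1988RG2Cluster, Lemma 3 (2.38) p.20 and (2.41) p.21] -/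
theorem endpoint_and_n26_datumOfRecord₁₃Core_of_drift_atSlopeCont (hc : θ.Provisos₁₃Core F N) {d A γ₀ : ℝ}
    (hdrift : letI := θ.instVβ₁; letI := θ.instVβ₂; letI := θ.instιβ
      OneLoopDrift d A
        (beta0OfMerged (betaMerged F (mergedTermFamilyMatT F N (TcanOfRecord F N) (chiFixed29 F N θ.ν θ.ε₂₉) θ.εbg) θ.ρ8 θ.bV) θ.v₀))
    (hγ₀ : 0 < γ₀)
    (hres : letI := θ.instVβ₁; letI := θ.instVβ₂; letI := θ.instιβ
      AtSlopeCont
        (oneLoopSplit_betaOfMerged (betaMerged F (mergedTermFamilyMatT F N (TcanOfRecord F N) (chiFixed29 F N θ.ν θ.ε₂₉) θ.εbg) θ.ρ8 θ.bV)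
          (beta0OfMerged (betaMerged F (mergedTermFamilyMatT F N (TcanOfRecord F N) (chiFixed29 F N θ.ν θ.ε₂₉) θ.εbg) θ.ρ8 θ.bV) θ.v₀) θ.γ)
        γ₀ d) :
    EndpointExistence (datumOfRecord₁₃Core F N θ hc).C.toB12 ∧ ∃ γc : ℝ, 0 < γc ∧ BetaContH γc (datumOfRecord₁₃Core F N θ hc).βfun :=
  ⟨endpointExistence_of_drift_remainderConst_cont (datumOfRecord₁₃Core F N θ hc).fwd (oneLoopSplit_betaOfMerged _ _ _) hγ₀ hdrift
      (remainderConst_of_atSlopeCont hres) le_rfl (betaContH_of_atSlopeCont hres),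
    γ₀, hγ₀, betaContH_of_atSlopeCont hres⟩

end AtDatum

/-! ## §2 The junction shape for composers, and the v1.2 face recovered from Core (the pattern every edition repeats) -/

section Junction

variable (θ : Stage13Params F N)

/-- **THE JUNCTION SHAPE**: for ANY finite-ε datum `D` with `D = datumOfRecord₁₃Core F N θ hc` (what an edition's record predicate delivers after `.toCore`), the jets-free pair at θ ⟹
`EndpointExistence D.C.toB12 ∧ ∃ γc > 0, BetaContH γc D.βfun`.  Instance 0∕1. [cite: Balaban1987RG1, Thm 2 p.259 (first sentence) and (1.20)–(1.22) p.264; Balaban1988RG2Cluster, Lemma 3 (2.38) p.20] -/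
theorem endpoint_and_n26_of_eq_datumOfRecord₁₃Core_of_drift_atSlopeCont {D : FiniteEpsData F (Matrix.specialUnitaryGroup (Fin N) ℂ)}
    (hc : θ.Provisos₁₃Core F N) (hD : D = datumOfRecord₁₃Core F N θ hc) {d A γ₀ : ℝ}
    (hdrift : letI := θ.instVβ₁; letI := θ.instVβ₂; letI := θ.instιβ
      OneLoopDrift d A
        (beta0OfMerged (betaMerged F (mergedTermFamilyMatT F N (TcanOfRecord F N) (chiFixed29 F N θ.ν θ.ε₂₉) θ.εbg) θ.ρ8 θ.bV) θ.v₀))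
    (hγ₀ : 0 < γ₀)
    (hres : letI := θ.instVβ₁; letI := θ.instVβ₂; letI := θ.instιβ
      AtSlopeCont
        (oneLoopSplit_betaOfMerged (betaMerged F (mergedTermFamilyMatT F N (TcanOfRecord F N) (chiFixed29 F N θ.ν θ.ε₂₉) θ.εbg) θ.ρ8 θ.bV)
          (beta0OfMerged (betaMerged F (mergedTermFamilyMatT F N (TcanOfRecord F N) (chiFixed29 F N θ.ν θ.ε₂₉) θ.εbg) θ.ρ8 θ.bV) θ.v₀) θ.γ)
        γ₀ d) :
    EndpointExistence D.C.toB12 ∧ ∃ γc : ℝ, 0 < γc ∧ BetaContH γc D.βfun := by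
  subst hD
  exact endpoint_and_n26_datumOfRecord₁₃Core_of_drift_atSlopeCont F N θ hc hdrift hγ₀ hres

/- USE (not a declaration — the statement IS p504252's `endpoint_and_n26_datumOfRecord₁₃Sep_of_drift_atSlopeCont`, dedup.landed): the v1.2 face is RECOVERED from the Core
face in one line, `endpoint_and_n26_datumOfRecord₁₃Core_of_drift_atSlopeCont F N θ hP.toCore hdrift hγ₀ hres` (datum by `rfl`, def-T `datumOfRecord₁₃Sep_eq_core`) — the pattern
the v1.3 (`SepMixed`) and every later edition repeats with its own `h.toCore`; no further re-key of this lineage's datum-level faces is needed. -/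

end Junction

end Summit.QuantumFields.YangMills.Theorems.BalabanUVNodesN26AtRecord13Core

end
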